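import Mathlib.Analysis.Matrix.Order
import Mathlib.Data.List.Sublists
import HarnessLib

/-!
# Fidelity with a stabilizer state from stabilizer expectation values (direct fidelity estimation; the generator bound)

HONEST FRAMING (cell `pub-qadeq`, lane harvest-2): instance-level adjudication of specific
advantage claims; no claim about BQP vs BPP or the summit. This file is cited VOCABULARY for the
CERTIFICATE language of the lane's "verifiable-fidelity" sampling row E-46 (Martiel et al. 2026:
the Clifford reference state's fidelity `F₁ = 0.32(1)` is obtained by "direct fidelity estimation
… 80 stabilizers × 250,000 shots", the input of the tree's `PostselectedFidelityBound.lean`).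
Nothing here is asserted about any device or any classical cost.

## Sources and the printed statements

* S. T. Flammia, Y.-K. Liu, *Direct fidelity estimation from few Pauli measurements*, Phys. Rev.
  Lett. **106**, 230501 (2011) = arXiv:1104.4695 [FlammiaLiu2011]; held text
  `paper:arxiv-1104.4695`. Eq. (1)–(2) (p0002 L20–33): for a pure target `ρ`,
  "`F(ρ,σ) = Tr(ρσ)`", "`Tr(ρσ) = Σ_k χ_ρ(k) χ_σ(k)`" with `χ_ρ(k) = Tr(ρW_k/√d)` over all `d²`
  Pauli operators; p0002 L35: "if `ρ` is a stabilizer state, `χ_ρ(k)` takes on values of `±1/√d` at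
  the `d` points in the stabilizer group of `ρ`, and vanishes everywhere else. So the sum in (2)
  contains only `d` terms, and one can compute `Tr(ρσ)` by measuring only `d` Pauli operators.
  Furthermore, to merely estimate `Tr(ρσ)` one only needs to measure a small random subset of
  these Pauli operators"; eq. (4) p0003 L5–8: the estimator `X = χ_σ(k)/χ_ρ(k)`, "`𝔼X = Tr(ρσ)`";
  p0003 L63–66: stabilizer states are "well-conditioned with `α = 1`", "`|X| ≤ 1/α`", Hoeffding
  then gives `ℓ = O(log(1/δ)/(α²ε²))` settings.
* A. Kalev, A. Kyrillidis, N. M. Linke, *Validating and certifying stabilizer states*, Phys. Rev. A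
  **99**, 042337 (2019) = arXiv:1808.10786 [KalevKyrillidisLinke2019]; held text
  `paper:arxiv-1808.10786`. Eq. (stab), p0004 L10–17: an `n`-qubit stabilizer state is the unique
  joint `+1` eigenstate of its stabilizer group `𝒮 = {P_l}` (`2ⁿ` commuting Pauli operators) with
  generators `𝒢`, and "`ρ₀ ≡ |Ψ₀⟩⟨Ψ₀| = 2^{−n} ∏_{P_l∈𝒢} (𝟙 + P_l) = 2^{−n} Σ_{P_l∈𝒮} P_l`";
  Proposition 1 with its proof, p0005 L50–p0006 L44: from the measured generator expectations
  `μ̃_l` the worst-case fidelity is "`λ₀ = 1 − Σ_{l=0}^{n−1} (1 − μ̃_l)/2 ≥ 0`" (when this quantity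
  is non-negative; zero otherwise) — in particular every state with generator expectations `μ_l`
  has fidelity `F ≥ 1 − Σ_l (1 − μ_l)/2` with `|Ψ₀⟩`.

## How it is typed (abstractly; what is an INPUT)

A *stabilizer family* is a list `g = [g₁,…,gₙ]` of pairwise commuting Hermitian involutions
(`gᴴ = g`, `g² = 1`) in `Matrix ι ι ℂ` — the generators; `halfProj g_l = ½(1 + g_l)` are then
commuting orthogonal projections and `codeProj g = ∏_l ½(1 + g_l)` (ordered product) is the
projector onto the joint `+1` eigenspace. That this projector IS `|Ψ₀⟩⟨Ψ₀|` for `n` independent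
generators on `n` qubits (a dimension count) is eq. (stab)'s first equality and is NOT re-proved
here (the tree's `StabilizerProjector.lean` has the operational version for Clifford orbits); every
statement below is about `Tr(ρ · codeProj g)`, which is the fidelity with `|Ψ₀⟩` in that case and the
weight of `ρ` on the stabilized subspace in general.

## Contents (all proved; 0 named facts, 0 `sorry`)

* `prod_map_one_add_eq_sum_sublists` — in any semiring, `∏_l (1 + g_l) = Σ_{S ⊑ g} ∏_{x∈S} x`
  (ordered sublists; no commutativity needed); hence **`codeProj_eq_smul_stabilizerSum`** — the
  second equality of eq. (stab): `∏_l ½(1 + g_l) = 2^{−n} Σ_{S ⊑ g} ∏ S` (the `2ⁿ` ordered products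
  are the stabilizer-group elements when the `g_l` commute), with `length_sublists' = 2ⁿ`.
* **`trace_mul_codeProj_eq`** — Flammia–Liu's stabilizer case: `Tr(ρ ∏_l ½(1+g_l))
  = 2^{−n} Σ_{S} Tr(ρ ∏S)`, i.e. the fidelity is the MEAN of the `2ⁿ` stabilizer expectation values
  (so sampling stabilizer elements uniformly is an unbiased estimator with values in `[−1, 1]`).
* `isProj_halfProj`, `isProj_codeProj` (private helpers: commuting projections multiply to a
  projection; `1 − P` is a projection; a projection is positive semidefinite as `P = PᴴP`).
* **`posSemidef_sum_sub`** — the operator inequality behind Proposition 1 / the Tóth–Gühne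
  witness: `Σ_l (1 − ½(1+g_l)) − (1 − ∏_l ½(1+g_l))` is positive semidefinite (induction on the list:
  the increment is the product `(1 − Π_k)(1 − P_{k+1})` of two commuting projections).
* (private) `trace_mul_nonneg_of_posSemidef` — `0 ≤ Tr(ρX)` for positive semidefinite `ρ`, `X`
  (via the square root provided by Mathlib's matrix star order).
* **`fidelity_ge_one_sub_sum`** — Kalev–Kyrillidis–Linke Prop. 1 (the bound direction) /
  the generator witness: for a density matrix `ρ` (positive semidefinite, trace `1`),
  `Re Tr(ρ ∏_l ½(1+g_l)) ≥ 1 − Σ_l (1 − Re Tr(ρ g_l))/2`.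
* `settings_wellConditioned` — the arithmetic of the stabilizer ("`α = 1`") sample bound:
  Hoeffding's `2 exp(−ℓε²/2) ≤ δ ⇔ ℓ ≥ 2 log(2/δ)/ε²` for an estimator bounded by `1`.

## What is NOT here (stated, not formalised)

The identification `∏_l ½(1+g_l) = |Ψ₀⟩⟨Ψ₀|` (needs `n` independent generators on `n` qubits);
that the ordered products over sublists enumerate the stabilizer GROUP without repetition (needs
independence); the importance-sampling protocol for general (non-stabilizer) pure states and its
Chebyshev/Hoeffding analysis as probability statements (eqs. (3)–(8) of Flammia–Liu); the
worst-case ATTAINMENT half of Proposition 1 (existence of a consistent state with fidelity exactly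
`1 − Σ(1−μ̃_l)/2`) and its Corollaries 3–4 (finite statistics); measurement errors (§ Discussion).

## Why the lane holds it (E-link; quotation from the lane's own materialisation)

* E-46 (Martiel et al., arXiv:2607.25941v1 [MartielEtAl2026]) p4 L56–59, as already quoted in
  `Literature/Computability/QuantumComplexity/PostselectedFidelityBound.lean`: the undoped Clifford
  reference fidelity "`F₁ = 0.32(1)`" is measured by "direct fidelity estimation" with "80
  stabilizers × 250,000 shots" — i.e. the uniform-stabilizer-sampling estimator whose unbiasedness
  is `trace_mul_codeProj_eq` below; `PostselectedFidelityBound.cliffordFidelity_sub_le_dopedFidelity`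
  then turns `F₁` into the advertised bound `F₂ ≥ 0.284`.

## References

* [FlammiaLiu2011] S. T. Flammia, Y.-K. Liu, Phys. Rev. Lett. 106, 230501 (2011), eqs. (1)–(4).
* [KalevKyrillidisLinke2019] A. Kalev, A. Kyrillidis, N. M. Linke, Phys. Rev. A 99, 042337 (2019),
  eq. (2) [= (stab)] and Proposition 1.
* [MartielEtAl2026] S. Martiel et al., arXiv:2607.25941 (2026), Fig. 3 / p. 4.
-/

noncomputable section

open Matrix
open scoped ComplexOrder MatrixOrder

namespace Literature.InformationTheory.QuantumLearning

namespace StabilizerDFE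

variable {ι : Type*} [Fintype ι] [DecidableEq ι]

/-! ### The product expansion `∏ (1 + g_l) = Σ_{S} ∏ S` (no commutativity needed) -/

/-- In any semiring, the ordered product `∏_l (1 + g_l)` over a list expands as the sum, over the
ordered sublists `S` of the list, of the ordered products `∏_{x∈S} x`.
[cite: KalevKyrillidisLinke2019, eq. (2) p0004 L17 (the expansion `∏(𝟙 + P_l) = Σ_{𝒮} P_l`)] -/
theorem prod_map_one_add_eq_sum_sublists {R : Type*} [Semiring R] (g : List R) :
    (g.map fun x => 1 + x).prod = ((List.sublists' g).map List.prod).sum := by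
  induction g with
  | nil => simp
  | cons a l ih =>
      rw [List.map_cons, List.prod_cons, ih, List.sublists'_cons, List.map_append, List.sum_append,
        List.map_map, add_mul, one_mul]
      congr 1
      rw [← List.sum_map_mul_left]
      rfl

/-! ### Stabilizer families, the code projector and the stabilizer sum -/

/-- A STABILIZER FAMILY (the generators): pairwise commuting Hermitian involutions.
[cite: KalevKyrillidisLinke2019, §II p0004 L10–12 ("`2ⁿ` commuting `n`-qubit Pauli operators …
`P_l ∈ {±1, ±i}·{I, X, Y, Z}^{⊗n}`" with eigenvalue `1` on `|Ψ₀⟩`)] -/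
structure IsStabilizerFamily (g : List (Matrix ι ι ℂ)) : Prop where
  herm : ∀ x ∈ g, xᴴ = x
  invol : ∀ x ∈ g, x * x = 1
  comm : g.Pairwise Commute

/-- `½(𝟙 + g)`: the projector onto the `+1` eigenspace of an involution `g`.
[cite: KalevKyrillidisLinke2019, eq. (2) p0004 L17; proof of Prop. 1 p0006 L16–25] -/
def halfProj (x : Matrix ι ι ℂ) : Matrix ι ι ℂ := (1 / 2 : ℂ) • (1 + x)

omit [Fintype ι] in
/-- Unfolding `halfProj`. [cite: KalevKyrillidisLinke2019, eq. (2) p0004 L17] -/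
theorem halfProj_eq (x : Matrix ι ι ℂ) : halfProj x = (1 / 2 : ℂ) • (1 + x) := rfl

/-- The code projector `∏_l ½(𝟙 + g_l)` (ordered product over the generator list); for `n`
independent generators on `n` qubits this is `|Ψ₀⟩⟨Ψ₀|` (eq. (stab), first equality — not
re-proved here). [cite: KalevKyrillidisLinke2019, eq. (2) p0004 L17] -/
def codeProj (g : List (Matrix ι ι ℂ)) : Matrix ι ι ℂ := (g.map halfProj).prod

/-- The stabilizer sum `Σ_{S ⊑ g} ∏_{x∈S} x` over the `2ⁿ` ordered sublists of the generator list
(the elements of the stabilizer group generated by `g`). [cite: KalevKyrillidisLinke2019, eq. (2) p0004 L17] -/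
def stabilizerSum (g : List (Matrix ι ι ℂ)) : Matrix ι ι ℂ := ((List.sublists' g).map List.prod).sum

omit [Fintype ι] [DecidableEq ι] in
/-- There are `2ⁿ` stabilizer products. [cite: KalevKyrillidisLinke2019, §II p0004 L10 ("`2ⁿ` commuting … Pauli operators")] -/
theorem length_sublists' (g : List (Matrix ι ι ℂ)) : (List.sublists' g).length = 2 ^ g.length :=
  List.length_sublists' g

/-- `codeProj` of the empty family is `1`; of `x :: g` it is `½(1+x) · codeProj g`. [folklore] -/
private theorem codeProj_cons (x : Matrix ι ι ℂ) (g : List (Matrix ι ι ℂ)) :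
    codeProj (x :: g) = halfProj x * codeProj g := by
  simp [codeProj]

/-- **Eq. (stab), second equality**: `∏_l ½(𝟙 + g_l) = 2^{−n} Σ_{S ⊑ g} ∏ S`.
[cite: KalevKyrillidisLinke2019, eq. (2) p0004 L17] -/
theorem codeProj_eq_smul_stabilizerSum (g : List (Matrix ι ι ℂ)) :
    codeProj g = ((1 / 2 : ℂ) ^ g.length) • stabilizerSum g := by
  rw [codeProj, stabilizerSum, ← prod_map_one_add_eq_sum_sublists]
  induction g with
  | nil => simp
  | cons a l ih =>
      rw [List.map_cons, List.prod_cons, ih, List.map_cons, List.prod_cons, List.length_cons,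
        pow_succ, halfProj_eq, smul_mul_smul_comm, mul_comm ((1 / 2 : ℂ) ^ l.length), mul_smul]

/-- **Direct fidelity estimation, stabilizer case**: `Tr(ρ ∏_l ½(𝟙+g_l)) = 2^{−n} Σ_{S} Tr(ρ ∏S)` —
the fidelity with the stabilizer state is the MEAN of the `2ⁿ` stabilizer expectation values, so
the uniformly sampled stabilizer expectation value is an unbiased estimator of it ("one can compute
`Tr(ρσ)` by measuring only `d` Pauli operators … to merely estimate `Tr(ρσ)` one only needs to
measure a small random subset of these", "`𝔼X = Tr(ρσ)`").
[cite: FlammiaLiu2011, eq. (2) and p0002 L35, eq. (4) p0003 L5–8] -/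
theorem trace_mul_codeProj_eq (ρ : Matrix ι ι ℂ) (g : List (Matrix ι ι ℂ)) :
    (ρ * codeProj g).trace
      = ((1 / 2 : ℂ) ^ g.length) * (((List.sublists' g).map fun S => (ρ * S.prod).trace).sum) := by
  rw [codeProj_eq_smul_stabilizerSum, Matrix.mul_smul, Matrix.trace_smul, smul_eq_mul,
    stabilizerSum, ← List.sum_map_mul_left, Matrix.trace_list_sum, List.map_map]
  rfl

/-! ### Projections -/

/-- An orthogonal projection: Hermitian and idempotent ("the projection operators `(𝟙 ± P_l)/2`
associated with the stabilizer generators"). [cite: KalevKyrillidisLinke2019, proof of Prop. 1 p0006 L16–18] -/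
structure IsProj (P : Matrix ι ι ℂ) : Prop where
  herm : Pᴴ = P
  idem : P * P = P

/-- `½(𝟙 + g)` is an orthogonal projection when `g` is a Hermitian involution.
[cite: KalevKyrillidisLinke2019, proof of Prop. 1 p0006 L16–18 ("the projection operators `(𝟙 ± P_l)/2`")] -/
theorem isProj_halfProj {x : Matrix ι ι ℂ} (hh : xᴴ = x) (hi : x * x = 1) : IsProj (halfProj x) := by
  refine ⟨?_, ?_⟩
  · rw [halfProj_eq, conjTranspose_smul, conjTranspose_add, conjTranspose_one, hh]
    norm_num
  · rw [halfProj_eq, smul_mul_smul_comm, add_mul, mul_add, mul_add, one_mul, mul_one, one_mul, hi]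
    rw [show (1 : Matrix ι ι ℂ) + x + (x + 1) = (2 : ℂ) • (1 + x) by rw [two_smul]; abel, smul_smul]
    norm_num

omit [DecidableEq ι] in
/-- Commuting orthogonal projections multiply to an orthogonal projection. [folklore] -/
private theorem isProj_mul {P Q : Matrix ι ι ℂ} (hP : IsProj P) (hQ : IsProj Q) (hc : Commute P Q) :
    IsProj (P * Q) := by
  refine ⟨?_, ?_⟩
  · rw [conjTranspose_mul, hP.herm, hQ.herm, hc.eq]
  · calc P * Q * (P * Q) = P * (Q * P) * Q := by simp only [Matrix.mul_assoc]
      _ = P * (P * Q) * Q := by rw [hc.eq]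
      _ = (P * P) * (Q * Q) := by simp only [Matrix.mul_assoc]
      _ = P * Q := by rw [hP.idem, hQ.idem]

/-- `1 − P` is an orthogonal projection when `P` is. [folklore] -/
private theorem isProj_one_sub {P : Matrix ι ι ℂ} (hP : IsProj P) : IsProj (1 - P) := by
  refine ⟨?_, ?_⟩
  · rw [conjTranspose_sub, conjTranspose_one, hP.herm]
  · rw [sub_mul, mul_sub, mul_sub, one_mul, one_mul, mul_one, hP.idem, sub_self, sub_zero]

omit [DecidableEq ι] in
/-- An orthogonal projection is positive semidefinite (`P = PᴴP`). [folklore] -/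
private theorem posSemidef_of_isProj {P : Matrix ι ι ℂ} (hP : IsProj P) : P.PosSemidef := by
  have h : P = Pᴴ * P := by rw [hP.herm, hP.idem]
  rw [h]
  exact posSemidef_conjTranspose_mul_self P

/-- The head generator's projection commutes with the code projector of the tail.
[cite: KalevKyrillidisLinke2019, §II p0005 L29 ("the generators are mutually commuting")] -/
theorem commute_halfProj_codeProj {x : Matrix ι ι ℂ} {g : List (Matrix ι ι ℂ)}
    (hc : ∀ y ∈ g, Commute x y) : Commute (halfProj x) (codeProj g) := by
  induction g with
  | nil => simp [codeProj]
  | cons a l ih =>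
      rw [codeProj_cons]
      have ha : Commute x a := hc a (by simp)
      have hxa : Commute (halfProj x) (halfProj a) := by
        rw [halfProj_eq, halfProj_eq]
        exact (((Commute.one_left (1 + a)).add_left ((Commute.one_right x).add_right ha)).smul_right
          (1 / 2 : ℂ)).smul_left (1 / 2 : ℂ)
      exact hxa.mul_right (ih fun y hy => hc y (by simp [hy]))

/-- The code projector of a stabilizer family is an orthogonal projection.
[cite: KalevKyrillidisLinke2019, eq. (2) p0004 L17] -/
theorem isProj_codeProj {g : List (Matrix ι ι ℂ)} (hg : IsStabilizerFamily g) : IsProj (codeProj g) := by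
  induction g with
  | nil => exact ⟨by simp [codeProj], by simp [codeProj]⟩
  | cons a l ih =>
      rw [codeProj_cons]
      have hl : IsStabilizerFamily l :=
        ⟨fun x hx => hg.herm x (by simp [hx]), fun x hx => hg.invol x (by simp [hx]),
          (List.pairwise_cons.mp hg.comm).2⟩
      exact isProj_mul (isProj_halfProj (hg.herm a (by simp)) (hg.invol a (by simp))) (ih hl)
        (commute_halfProj_codeProj (List.pairwise_cons.mp hg.comm).1)

/-! ### The operator inequality `1 − ∏ P_l ≤ Σ (1 − P_l)` and Proposition 1 -/

/-- `Σ_l (1 − ½(1+g_l))` over the generator list. [cite: KalevKyrillidisLinke2019, proof of Prop. 1 p0006 L28–44] -/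
def deficitSum (g : List (Matrix ι ι ℂ)) : Matrix ι ι ℂ := (g.map fun x => 1 - halfProj x).sum

/-- **The witness inequality** (operator form of Proposition 1 / the Tóth–Gühne stabilizer witness):
for a stabilizer family, `Σ_l (1 − ½(1+g_l)) − (1 − ∏_l ½(1+g_l))` is positive semidefinite.
Induction on the list: the increment is `(1 − Π_tail)(1 − P_head)`, a product of two commuting
orthogonal projections, hence a projection, hence positive.
[cite: KalevKyrillidisLinke2019, Prop. 1 and its proof p0005 L50–p0006 L44] -/
theorem posSemidef_sum_sub {g : List (Matrix ι ι ℂ)} (hg : IsStabilizerFamily g) :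
    (deficitSum g - (1 - codeProj g)).PosSemidef := by
  induction g with
  | nil => simp [deficitSum, codeProj, PosSemidef.zero]
  | cons a l ih =>
      have hl : IsStabilizerFamily l :=
        ⟨fun x hx => hg.herm x (by simp [hx]), fun x hx => hg.invol x (by simp [hx]),
          (List.pairwise_cons.mp hg.comm).2⟩
      have hPa : IsProj (halfProj a) := isProj_halfProj (hg.herm a (by simp)) (hg.invol a (by simp))
      have hPl : IsProj (codeProj l) := isProj_codeProj hl
      have hcomm : Commute (halfProj a) (codeProj l) :=
        commute_halfProj_codeProj (List.pairwise_cons.mp hg.comm).1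
      -- the increment `(1 − P_a)(1 − Π_l)` is a projection, hence PSD
      have hc2 : Commute (1 - halfProj a) (1 - codeProj l) :=
        (Commute.one_left _).sub_left ((Commute.one_right _).sub_right hcomm)
      have hinc : ((1 - halfProj a) * (1 - codeProj l)).PosSemidef :=
        posSemidef_of_isProj (isProj_mul (isProj_one_sub hPa) (isProj_one_sub hPl) hc2)
      have key : deficitSum (a :: l) - (1 - codeProj (a :: l))
          = (deficitSum l - (1 - codeProj l)) + (1 - halfProj a) * (1 - codeProj l) := by
        rw [deficitSum, List.map_cons, List.sum_cons, ← deficitSum, codeProj_cons]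
        noncomm_ring
      rw [key]
      exact ih hl |>.add hinc

/-- `0 ≤ Tr(ρX)` for positive semidefinite `ρ` and `X` (through `ρ = √ρ√ρ`, Mathlib's matrix star
order). [folklore] -/
private theorem trace_mul_nonneg_of_posSemidef {ρ X : Matrix ι ι ℂ} (hρ : ρ.PosSemidef) (hX : X.PosSemidef) :
    0 ≤ (ρ * X).trace := by
  obtain ⟨B, hB⟩ : ∃ B : Matrix ι ι ℂ, ρ = Bᴴ * B := by
    obtain ⟨S, hS, -, hSS⟩ :=
      CFC.exists_sqrt_of_isSelfAdjoint_of_quasispectrumRestricts hρ.isHermitian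
        (QuasispectrumRestricts.nnreal_of_nonneg hρ.nonneg)
    exact ⟨S, by rw [← hSS, ← star_eq_conjTranspose, hS.star_eq]⟩
  rw [hB, Matrix.mul_assoc, Matrix.trace_mul_comm]
  exact (hX.mul_mul_conjTranspose_same B).trace_nonneg

omit [Fintype ι] [DecidableEq ι] in
/-- Real part of a list sum. [folklore] -/
private theorem re_list_sum (l : List ℂ) : l.sum.re = (l.map Complex.re).sum := by
  induction l with
  | nil => simp
  | cons a l ih => rw [List.sum_cons, Complex.add_re, ih, List.map_cons, List.sum_cons]

/-- Trace of `ρ(1 − ½(1+g))` in terms of `Tr(ρg)`: `Tr(ρ) − Tr(ρ ½(1+g)) = (Tr ρ − Tr(ρg))/2`.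
[cite: KalevKyrillidisLinke2019, proof of Prop. 1 p0006 L28 ("`tr((𝟙−P_l)/2 ρ) = (1−μ̃_l)/2`")] -/
theorem trace_mul_one_sub_halfProj (ρ x : Matrix ι ι ℂ) :
    (ρ * (1 - halfProj x)).trace = (ρ.trace - (ρ * x).trace) / 2 := by
  rw [halfProj_eq, mul_sub, mul_one, Matrix.mul_smul, mul_add, mul_one, trace_sub, trace_smul,
    trace_add, smul_eq_mul]
  ring

/-- Trace of `ρ · deficitSum g` as a sum over generators. [cite: KalevKyrillidisLinke2019, proof of Prop. 1 p0006 L28–44] -/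
theorem trace_mul_deficitSum (ρ : Matrix ι ι ℂ) (g : List (Matrix ι ι ℂ)) :
    (ρ * deficitSum g).trace = (g.map fun x => (ρ.trace - (ρ * x).trace) / 2).sum := by
  induction g with
  | nil => simp [deficitSum]
  | cons a l ih =>
      rw [deficitSum, List.map_cons, List.sum_cons, ← deficitSum, mul_add, trace_add,
        trace_mul_one_sub_halfProj, ih, List.map_cons, List.sum_cons]

/-- **Proposition 1 (bound direction) / the generator witness**: for a density matrix `ρ`
(positive semidefinite, trace `1`) and a stabilizer family `g`,
`Re Tr(ρ ∏_l ½(1+g_l)) ≥ 1 − Σ_l (1 − Re Tr(ρ g_l))/2` — "`λ₀ = 1 − Σ_l (1 − μ̃_l)/2`" is the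
worst-case fidelity. [cite: KalevKyrillidisLinke2019, Proposition 1 p0005 L50–p0006 L44] -/
theorem fidelity_ge_one_sub_sum {ρ : Matrix ι ι ℂ} (hρ : ρ.PosSemidef) (htr : ρ.trace = 1)
    {g : List (Matrix ι ι ℂ)} (hg : IsStabilizerFamily g) :
    1 - (g.map fun x => (1 - ((ρ * x).trace).re) / 2).sum ≤ ((ρ * codeProj g).trace).re := by
  have h0 := trace_mul_nonneg_of_posSemidef hρ (posSemidef_sum_sub hg)
  rw [mul_sub, mul_sub, mul_one, trace_sub, trace_sub, htr, trace_mul_deficitSum, htr] at h0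
  have hre := (Complex.nonneg_iff.mp h0).1
  rw [Complex.sub_re, Complex.sub_re, Complex.one_re, re_list_sum, List.map_map] at hre
  have hmap : (List.map (Complex.re ∘ fun x => (1 - (ρ * x).trace) / 2) g)
      = List.map (fun x => (1 - ((ρ * x).trace).re) / 2) g := by
    refine List.map_congr_left fun x _ => ?_
    simp
  rw [hmap] at hre
  linarith

/-! ### The `α = 1` sample bound for stabilizer targets -/

/-- For a stabilizer target the estimator is bounded by `1` ("well-conditioned with `α = 1`",
"`|X| ≤ 1/α`"), so Hoeffding's two-sided tail `2 exp(−ℓε²/2)` for means of `[−1,1]`-valued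
samples is below `δ` exactly when `ℓ ≥ 2 log(2/δ)/ε²` — the `O(log(1/δ)/(α²ε²))` count of
settings at `α = 1`; the probabilistic inequality itself is not formalised here.
[cite: FlammiaLiu2011, p0003 L63–66] -/
theorem settings_wellConditioned {ℓ ε δ : ℝ} (hε : 0 < ε) (hδ : 0 < δ) :
    2 * Real.exp (-(ℓ * ε ^ 2) / 2) ≤ δ ↔ 2 * Real.log (2 / δ) / ε ^ 2 ≤ ℓ := by
  have hε2 : 0 < ε ^ 2 := by positivity
  rw [div_le_iff₀ hε2, Real.log_div (by norm_num) hδ.ne']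
  constructor
  · intro h
    have h1 : Real.exp (-(ℓ * ε ^ 2) / 2) ≤ δ / 2 := by linarith
    have h2 := (Real.le_log_iff_exp_le (by positivity)).mpr h1
    rw [Real.log_div hδ.ne' (by norm_num)] at h2
    linarith
  · intro h
    have h1 : -(ℓ * ε ^ 2) / 2 ≤ Real.log (δ / 2) := by
      rw [Real.log_div hδ.ne' (by norm_num)]
      linarith
    have h2 := (Real.le_log_iff_exp_le (by positivity)).mp h1
    linarith

end StabilizerDFE

end Literature.InformationTheory.QuantumLearning

end
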